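import Literature.AlgebraicGeometry.Motives.HodgeLieWeilSquareRankOne
import Literature.AlgebraicGeometry.Motives.HodgeLieCommutantEigenspaces
import Literature.AlgebraicGeometry.Motives.HodgeLieComplexCenter
import Literature.Algebra.Lie.HomBimoduleOfTracelessMultiplications
import HarnessLib

/-!
# The Weil square, LIFT branch: a full raising corner `Hom(W⁻, W⁺) ⊆ 𝔥_ℂ|_W` and the membership criterion «`Lie Hg ⊗ ℂ ⊇ 𝔰𝔲_K(V, ψ) ⊗ ℂ`» — bricks S3-LIFT and S4 of the (3|3) WEIL square

Family `hodge`, layer `Literature/AlgebraicGeometry/Motives`, namespace `Literature.AlgebraicGeometry.Motives.HodgeStructure`, sub-namespace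
`WeilSquare`. THEOREMS ONLY (no definition, no named fact, no `sorry`). Written for the cell `pub-hodgeav-hg6` (req-37 (A) Q2b; eng-4 g7, bricks
S3-LIFT / S4 of `HOME/jobs/WEIL33-eng4g7/DESIGN.md` REV 4 §5–§6). HONEST FRAMING: nothing here proves HC / HC_AV / HC_CM; unconditional linear
algebra of polarized weight-one Hodge structures; no step towards a summit statement.

SETTING (`Motives/HodgeThetaSubalgebraUnitary`, `Motives/HodgeLieWeilSquareRankOne`): `H` effective polarized of weight `1`, `φ ∈ End_Hdg(V)`,
`φ² = −d` (`d > 0`), `End_Hdg(V) = ℚ + ℚφ`, `μ² = −d`, `W = ker(φ_ℂ − μ)`, `W̄ = ker(φ_ℂ + μ)`, `W⁺ = W ∩ V^{1,0}`, `W⁻ = W ∩ V^{0,1}`,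
`𝔥_ℂ = hodgeLieC H`, `𝔊⁰` = the elements of `𝔥_ℂ` preserving `V^{1,0}` and `V^{0,1}`, RAISING = `B V^{1,0} = 0`, `B V_ℂ ⊆ V^{1,0}`, LOWERING
dually. The hypothesis LIFT (conclusion of the LIFT alternative of `Literature.Algebra.Lie.LieGoursatTwist.lift_or_twist_of_submodules` for the pair
`(W⁺, W⁻)`): every traceless endomorphism of `W⁺` (resp. `W⁻`) is the restriction of an element of `𝔊⁰` VANISHING on `W⁻` (resp. `W⁺`).

* §1 `WeilSquare.raising_eq_zero_of_forall_minus` — a raising `N ∈ 𝔥_ℂ` vanishing on `W⁻` is `0` (second Hodge–Riemann relation on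
  `N(W̄ ∩ V^{0,1}) ⊆ W̄ ∩ V^{1,0}`, paired by `ψ_ℂ` with `W⁻`); `WeilSquare.exists_raising_apply_ne_zero` — when `𝔷(𝔥) = 0` some raising element
  of `𝔥_ℂ` is non-zero on `W⁻` (else `𝔥_ℂ = 𝔊⁰` centralises `Θ`, against `eq_zero_of_mem_hodgeLieC_of_forall_commute`).
* §2 **`WeilSquare.exists_raising_restrict_eq_of_lift`**, **`WeilSquare.exists_lowering_restrict_eq_of_lift`** — under LIFT, EVERY linear map
  `W⁻ → W⁺` (resp. `W⁺ → W⁻`) is the restriction of a raising (resp. lowering) element of `𝔥_ℂ`: the restrictions form a non-zero subspace of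
  `Hom(W⁻, W⁺)` stable under left composition with `𝔰𝔩(W⁺)` and right composition with `𝔰𝔩(W⁻)` (brackets with the lifts), hence everything
  (`Literature.Algebra.Lie.eq_top_of_forall_traceless_comp_mem`).
* §3 **`WeilSquare.mem_hodgeLieC_of_lift`** — under LIFT, every `Y ∈ End_ℂ(V_ℂ)` commuting with `φ_ℂ`, `ψ_ℂ`-skew and traceless on `W` lies in
  `𝔥_ℂ` («`Lie Hg ⊗ ℂ ⊇ 𝔰𝔲(W, h) ⊗ ℂ ≅ 𝔰𝔩(W)`», the generic member of TABLE X row 9): the four blocks of `Y|_W` in `W = W⁺ ⊕ W⁻` are matched by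
  lifts, raising / lowering elements and a multiple of `Θ` (trace bookkeeping `tr(Y|_W) = tr(π⁺Y|_{W⁺}) + tr(π⁻Y|_{W⁻})`), and an operator
  commuting with `φ_ℂ`, `ψ_ℂ`-skew and vanishing on `W` vanishes (`UnitaryTheta.eq_zero_of_forall_mem_eigenspace`).

## References

* [Gordon1997] B. B. Gordon, arXiv:alg-geom/9709030, §6 (proof of Thm. 6.3.3, pp. 18–19: `W ⊗ ℂ = W′ ⊕ W″`, `Hg = SU(W, h)` for Weil type).
* [MoonenZarhin1999LowDim] B. Moonen, Yu. Zarhin, Math. Ann. 315 (1999), §2 (2.3), §3 proof of Lemma (3.4).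
* [Deligne1982HodgeCycles] P. Deligne, LNM 900 (1982), I §3 (proof of Prop. 3.4), §4 (p. 30: Weil type, `Lie Hg ⊆ 𝔰𝔲`).
* [Ribet1976RealMultiplications] K. A. Ribet, Amer. J. Math. 98 (1976), pp. 790–791 (the LIFT alternative).
-/

noncomputable section

open scoped TensorProduct

namespace Literature.AlgebraicGeometry.Motives

namespace HodgeStructure

universe u

variable {V : Type u} [AddCommGroup V] [Module ℚ V] [Module.Finite ℚ V] [HodgeTensorFacts.{u, u}] {n : ℤ}

/-! ### §0 Plumbing: the trace of `G ∘ p` for a projector `p` onto an invariant subspace -/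

omit [Module.Finite ℚ V] [HodgeTensorFacts.{u, u}] in
/-- `tr_M(G ∘ p) = tr_U(G|_U)` for `p` with `p(M) ⊆ U`, `p = 1` on `U`, and `G` preserving `U`. Private plumbing. [folklore] -/
private theorem WeilSquare.trace_mul_proj_eq_trace_restrict {M : Type*} [AddCommGroup M] [Module ℂ M] [Module.Finite ℂ M]
    {U : Submodule ℂ M} {p G : Module.End ℂ M} (hpU : ∀ x, p x ∈ U) (hpid : ∀ u ∈ U, p u = u)
    (hG : ∀ u ∈ U, G u ∈ U) : LinearMap.trace ℂ M (G * p) = LinearMap.trace ℂ U (G.restrict hG) := by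
  classical
  have hcompl : IsCompl U (LinearMap.ker p) := by
    refine ⟨Submodule.disjoint_def.2 fun x hxU hxK => ?_, codisjoint_iff.2 (Submodule.eq_top_iff'.2 fun x => ?_)⟩
    · rw [LinearMap.mem_ker] at hxK
      rw [← hpid x hxU, hxK]
    · have hx : x = p x + (x - p x) := by abel
      rw [hx]
      refine Submodule.add_mem_sup (hpU x) ?_
      rw [LinearMap.mem_ker, map_sub, hpid _ (hpU x), sub_self]
  let N : Bool → Submodule ℂ M := fun b => cond b U (LinearMap.ker p)
  have hint : DirectSum.IsInternal N :=
    (DirectSum.isInternal_submodule_iff_isCompl N (i := true) (j := false) (by decide)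
      (Set.eq_univ_of_forall fun b => by cases b <;> simp).symm).2 hcompl
  have hU' : Set.MapsTo (G * p) U U := fun u hu => by
    simp only [SetLike.mem_coe] at hu ⊢
    rw [Module.End.mul_apply, hpid u hu]; exact hG u hu
  have hK' : Set.MapsTo (G * p) (LinearMap.ker p) (LinearMap.ker p) := fun x hx => by
    simp only [SetLike.mem_coe, LinearMap.mem_ker] at hx ⊢
    rw [Module.End.mul_apply, hx, map_zero, map_zero]
  have hmaps : ∀ b, Set.MapsTo (G * p) (N b) (N b) := fun b =>
    match b with
    | true => hU'
    | false => hK'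
  have hsplit := LinearMap.trace_eq_sum_trace_restrict hint hmaps
  rw [Fintype.sum_bool] at hsplit
  have h1 : LinearMap.trace ℂ (N true) ((G * p).restrict (hmaps true)) = LinearMap.trace ℂ U (G.restrict hG) := by
    change LinearMap.trace ℂ U ((G * p).restrict hU') = _
    congr 1
    exact LinearMap.ext fun u => Subtype.ext (by
      change (G * p) u = G u
      rw [Module.End.mul_apply, hpid u u.2])
  have h2 : LinearMap.trace ℂ (N false) ((G * p).restrict (hmaps false)) = 0 := by
    change LinearMap.trace ℂ (LinearMap.ker p) ((G * p).restrict hK') = 0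
    have h0 : (G * p).restrict hK' = 0 :=
      LinearMap.ext fun x => Subtype.ext (by
        change (G * p) x = 0
        rw [Module.End.mul_apply, LinearMap.mem_ker.1 x.2, map_zero])
    rw [h0, map_zero]
  rw [hsplit, h1, h2, add_zero]

/-! ### §1 Raising elements are detected on `W⁻`; some raising element is non-zero there -/

/-- **A raising `N ∈ 𝔥_ℂ` vanishing on `W⁻ = ker(φ_ℂ − μ) ∩ V^{0,1}` is zero.** For `x ∈ W̄ ∩ V^{0,1}`: `Nx ∈ W̄ ∩ V^{1,0}`, `conj(Nx) ∈ W⁻`, so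
`ψ_ℂ(Nx, conj(Nx)) = −ψ_ℂ(x, N conj(Nx)) = 0` and `Nx = 0` by the second Hodge–Riemann relation; `N` kills `V^{1,0}`, and
`V_ℂ = (W ∩ V^{1,0}) + W⁻ + (W̄ ∩ V^{1,0}) + (W̄ ∩ V^{0,1})`. (Apply with `−μ` for the mirror statement.)
[cite: Gordon1997, §6 (proof of Thm. 6.3.3, p. 19)] [cite: MoonenZarhin1999LowDim, §2 (2.3)] -/
theorem WeilSquare.raising_eq_zero_of_forall_minus (H : HodgeStructure V n) (hn : n = 1) (heff : H.IsEffective)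
    (ψ : H.Polarization) {φ : Module.End ℚ V} (hφE : φ ∈ H.endAlg) {d : ℚ} (hd : 0 < d) (hφ2 : φ * φ = -(d • 1)) {μ : ℂ}
    (hμ : μ ^ 2 = -(d : ℂ)) {N : Module.End ℂ (ℂ ⊗[ℚ] V)} (hN : N ∈ H.hodgeLieC) (hNP : ∀ p ∈ H.piece 1 0, N p = 0)
    (hNim : ∀ v, N v ∈ H.piece 1 0) (hNm : ∀ w ∈ Module.End.eigenspace (φ.baseChange ℂ) μ ⊓ H.piece 0 1, N w = 0) : N = 0 := by
  subst hn
  set W := Module.End.eigenspace (φ.baseChange ℂ) μ with hWdef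
  set ψC := ψ.form.baseChange ℂ with hψC
  obtain ⟨hμ0, hμc⟩ := UnitaryTheta.conj_eq_neg_of_sq hd hμ
  obtain ⟨Θ, hΘ⟩ := exists_hodgeTheta H
  obtain ⟨hPmem, hQmem, -, -, -⟩ := UnitaryTheta.theta_facts H rfl heff hΘ
  have hΘ𝔥 : Θ ∈ H.hodgeLieC := H.mem_hodgeLieC_of_forall_piece hΘ
  have hcφ : ∀ {Y}, Y ∈ H.hodgeLieC → Y * φ.baseChange ℂ = φ.baseChange ℂ * Y := fun {Y} hY =>
    H.commute_baseChange_of_mem_hodgeLieC hY ⟨φ, hφE⟩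
  have hYeig : ∀ {Y}, Y ∈ H.hodgeLieC → ∀ (c : ℂ), ∀ w ∈ Module.End.eigenspace (φ.baseChange ℂ) c,
      Y w ∈ Module.End.eigenspace (φ.baseChange ℂ) c := fun {Y} hY c w hw =>
    UnitaryTheta.apply_mem_eigenspace_of_commute (hcφ hY) hw
  have hPQ : ∀ x ∈ H.piece 1 0, conj x ∈ H.piece 0 1 := fun x hx => conj_mem_piece H hx
  have hcWbar : ∀ x ∈ Module.End.eigenspace (φ.baseChange ℂ) (-μ), conj x ∈ W := fun x hx =>
    (UnitaryTheta.conj_mem_eigenspace_iff' φ hμc x).2 hx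
  have hskewN : ∀ x y, ψC (N x) y = -ψC x (N y) := fun x y => formBaseChange_skew_of_mem_hodgeLieC ψ hN x y
  have hHR : ∀ {x : ℂ ⊗[ℚ] V} {p q : ℤ}, p + q = 1 → x ∈ H.piece p q → ψC x (conj x) = 0 → x = 0 := by
    intro x p q hpq hx h0
    by_contra hx0
    exact ψ.form_conj_ne_zero hpq hx hx0 h0
  -- `N` kills `W̄ ∩ V^{0,1}`
  have hNbar : ∀ x ∈ Module.End.eigenspace (φ.baseChange ℂ) (-μ), x ∈ H.piece 0 1 → N x = 0 := by
    intro x hx hxQ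
    have hNx : conj (N x) ∈ W ⊓ H.piece 0 1 := Submodule.mem_inf.2 ⟨hcWbar _ (hYeig hN _ x hx), hPQ _ (hNim x)⟩
    refine hHR (p := 1) (q := 0) (by norm_num) (hNim x) ?_
    rw [hskewN, hNm _ hNx, map_zero, neg_zero]
  -- `N` kills each eigenspace: split along `Θ`
  have hkill : ∀ (c : ℂ), (∀ x ∈ Module.End.eigenspace (φ.baseChange ℂ) c, x ∈ H.piece 0 1 → N x = 0) →
      ∀ x ∈ Module.End.eigenspace (φ.baseChange ℂ) c, N x = 0 := by
    intro c hc x hx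
    have hsplit : x = (2 : ℂ)⁻¹ • (x + Θ x) + (2 : ℂ)⁻¹ • (x - Θ x) := by
      rw [← smul_add, add_add_sub_cancel, ← two_smul ℂ x, smul_smul, inv_mul_cancel₀ (two_ne_zero' ℂ), one_smul]
    have hΘx : Θ x ∈ Module.End.eigenspace (φ.baseChange ℂ) c := hYeig hΘ𝔥 c x hx
    rw [hsplit, map_add, hNP _ (hPmem x), zero_add]
    exact hc _ (Submodule.smul_mem _ _ (Submodule.sub_mem _ hx hΘx)) (hQmem x)
  refine LinearMap.ext fun v => ?_
  obtain ⟨w, hw, w', hw', rfl⟩ := UnitaryTheta.exists_eigen_add_eigen hφ2 hμ hμ0 v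
  rw [map_add, LinearMap.zero_apply, hkill μ (fun x hx hxQ => hNm x (Submodule.mem_inf.2 ⟨hx, hxQ⟩)) w hw,
    hkill (-μ) hNbar w' hw', add_zero]

/-- **When `𝔷(𝔥) = 0`, some raising element of `𝔥_ℂ` is non-zero on `W⁻`.** Otherwise every raising element vanishes (§1), so does every
lowering one (complex conjugation), and `𝔥_ℂ = 𝔊⁰` centralises the Hodge operator `Θ ∈ 𝔥_ℂ`; but a central element of `𝔥_ℂ` is `0`
(`eq_zero_of_mem_hodgeLieC_of_forall_commute`), while `Θ = 1` on `W⁺ ≠ 0`.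
[cite: Deligne1982HodgeCycles, I §3 (proof of Prop. 3.4)] [cite: MoonenZarhin1999LowDim, §2 (2.3)] -/
theorem WeilSquare.exists_raising_apply_ne_zero (H : HodgeStructure V n) (hn : n = 1) (heff : H.IsEffective)
    (ψ : H.Polarization) {φ : Module.End ℚ V} (hφE : φ ∈ H.endAlg) {d : ℚ} (hd : 0 < d) (hφ2 : φ * φ = -(d • 1)) {μ : ℂ}
    (hμ : μ ^ 2 = -(d : ℂ)) (hz : H.hodgeLie ⊓ Subalgebra.toSubmodule H.endAlg = ⊥)
    (hWp : Module.End.eigenspace (φ.baseChange ℂ) μ ⊓ H.piece 1 0 ≠ ⊥) :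
    ∃ N ∈ H.hodgeLieC, (∀ p ∈ H.piece 1 0, N p = 0) ∧ (∀ v, N v ∈ H.piece 1 0) ∧
      ∃ w ∈ Module.End.eigenspace (φ.baseChange ℂ) μ ⊓ H.piece 0 1, N w ≠ 0 := by
  subst hn
  obtain ⟨Θ, hΘ⟩ := exists_hodgeTheta H
  obtain ⟨hPmem, hQmem, hΘ10, hΘ01, hΘΘ⟩ := UnitaryTheta.theta_facts H rfl heff hΘ
  have hΘ𝔥 : Θ ∈ H.hodgeLieC := H.mem_hodgeLieC_of_forall_piece hΘ
  have hbrC : ∀ Y ∈ H.hodgeLieC, ∀ Z ∈ H.hodgeLieC, Y * Z - Z * Y ∈ H.hodgeLieC := fun Y hY Z hZ => H.commutator_mem_hodgeLieC hY hZ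
  have hPQ : ∀ x ∈ H.piece 1 0, conj x ∈ H.piece 0 1 := fun x hx => conj_mem_piece H hx
  have hQP : ∀ x ∈ H.piece 0 1, conj x ∈ H.piece 1 0 := fun x hx => conj_mem_piece H hx
  by_contra hcon
  push Not at hcon
  -- every raising element vanishes
  have hraise : ∀ N ∈ H.hodgeLieC, (∀ p ∈ H.piece 1 0, N p = 0) → (∀ v, N v ∈ H.piece 1 0) → N = 0 := fun N hN hNP hNim =>
    WeilSquare.raising_eq_zero_of_forall_minus H rfl heff ψ hφE hd hφ2 hμ hN hNP hNim (hcon N hN hNP hNim)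
  -- every lowering element vanishes (its complex conjugate is raising)
  have hlower : ∀ M ∈ H.hodgeLieC, (∀ q ∈ H.piece 0 1, M q = 0) → (∀ v, M v ∈ H.piece 0 1) → M = 0 := by
    intro M hM hMQ hMim
    obtain ⟨N, hN⟩ := exists_conjOp M
    have hN𝔥 : N ∈ H.hodgeLieC := by
      rw [hodgeLieC_eq_spanC] at hM ⊢
      exact conjOp_mem_spanC hM hN
    have hNP : ∀ p ∈ H.piece 1 0, N p = 0 := fun p hp => by rw [hN, hMQ _ (hPQ p hp), map_zero]
    have hNim : ∀ v, N v ∈ H.piece 1 0 := fun v => by rw [hN]; exact hQP _ (hMim _)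
    have hN0 := hraise N hN𝔥 hNP hNim
    refine LinearMap.ext fun v => ?_
    have h := hN (conj v)
    rw [hN0, LinearMap.zero_apply, conj_conj] at h
    rw [LinearMap.zero_apply, ← conj_conj (M v), ← h, map_zero]
  -- hence `Θ` is central in `𝔥_ℂ`
  have hΘc : ∀ Y ∈ H.hodgeLieC, Θ * Y = Y * Θ := by
    intro Y hY
    obtain ⟨Zm, hZm, Z0, hZ0, Zp, hZp, hYeq, hZpP, hZpim, hZmQ, hZmim, -, -, hZ0P, hZ0Q⟩ :=
      SymplecticTheta.exists_decomp H.hodgeLieC hbrC hΘ𝔥 hΘΘ hΘ10 hΘ01 hPmem hQmem hY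
    rw [hYeq, hraise Zp hZp hZpP hZpim, hlower Zm hZm hZmQ hZmim, zero_add, add_zero]
    refine LinearMap.ext fun v => ?_
    have hsplit : v = (2 : ℂ)⁻¹ • (v + Θ v) + (2 : ℂ)⁻¹ • (v - Θ v) := by
      rw [← smul_add, add_add_sub_cancel, ← two_smul ℂ v, smul_smul, inv_mul_cancel₀ (two_ne_zero' ℂ), one_smul]
    rw [Module.End.mul_apply, Module.End.mul_apply, hsplit, map_add, map_add, map_add, map_add, hΘ10 _ (hPmem v),
      hΘ01 _ (hQmem v), hΘ10 _ (hZ0P _ (hPmem v)), hΘ01 _ (hZ0Q _ (hQmem v)), map_neg]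
  have hΘ0 : Θ = 0 := eq_zero_of_mem_hodgeLieC_of_forall_commute H hz hΘ𝔥 hΘc
  obtain ⟨p, hp, hp0⟩ := (Submodule.ne_bot_iff _).1 hWp
  have h := hΘ10 p (Submodule.mem_inf.1 hp).2
  rw [hΘ0, LinearMap.zero_apply] at h
  exact hp0 h.symm

/-! ### §2 LIFT ⟹ the raising (lowering) elements restrict to ALL of `Hom(W⁻, W⁺)` (`Hom(W⁺, W⁻)`) -/

/-- **LIFT ⟹ every linear map `W⁻ → W⁺` is the restriction of a raising element of `𝔥_ℂ`.** The restrictions `N|_{W⁻}` of the raising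
elements form a subspace `S ⊆ Hom(W⁻, W⁺)`, non-zero (§1), with `Z ∘ S ⊆ S` for traceless `Z ∈ End(W⁺)` (`[X_Z, N]`, `X_Z` the lift of `Z`
vanishing on `W⁻`) and `S ∘ Z ⊆ S` for traceless `Z ∈ End(W⁻)` (`[N, X'_Z]`); so `S` is everything
(`Literature.Algebra.Lie.eq_top_of_forall_traceless_comp_mem`). [cite: Ribet1976RealMultiplications, pp. 790–791]
[cite: Deligne1982HodgeCycles, I §3 (proof of Prop. 3.4)] -/
theorem WeilSquare.exists_raising_restrict_eq_of_lift (H : HodgeStructure V n) (hn : n = 1) (heff : H.IsEffective)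
    (ψ : H.Polarization) {φ : Module.End ℚ V} (hφE : φ ∈ H.endAlg) {d : ℚ} (hd : 0 < d) (hφ2 : φ * φ = -(d • 1)) {μ : ℂ}
    (hμ : μ ^ 2 = -(d : ℂ)) (hz : H.hodgeLie ⊓ Subalgebra.toSubmodule H.endAlg = ⊥)
    (hWp : 1 < Module.finrank ℂ ↥(Module.End.eigenspace (φ.baseChange ℂ) μ ⊓ H.piece 1 0))
    (hWm : 1 < Module.finrank ℂ ↥(Module.End.eigenspace (φ.baseChange ℂ) μ ⊓ H.piece 0 1))
    (hLp : ∀ Z : Module.End ℂ ↥(Module.End.eigenspace (φ.baseChange ℂ) μ ⊓ H.piece 1 0), LinearMap.trace ℂ _ Z = 0 →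
      ∃ X ∈ H.hodgeLieC, (∀ p ∈ H.piece 1 0, X p ∈ H.piece 1 0) ∧ (∀ q ∈ H.piece 0 1, X q ∈ H.piece 0 1) ∧
        (∀ p : ↥(Module.End.eigenspace (φ.baseChange ℂ) μ ⊓ H.piece 1 0), X p = Z p) ∧
        ∀ w ∈ Module.End.eigenspace (φ.baseChange ℂ) μ ⊓ H.piece 0 1, X w = 0)
    (hLm : ∀ Z : Module.End ℂ ↥(Module.End.eigenspace (φ.baseChange ℂ) μ ⊓ H.piece 0 1), LinearMap.trace ℂ _ Z = 0 →
      ∃ X ∈ H.hodgeLieC, (∀ p ∈ H.piece 1 0, X p ∈ H.piece 1 0) ∧ (∀ q ∈ H.piece 0 1, X q ∈ H.piece 0 1) ∧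
        (∀ w : ↥(Module.End.eigenspace (φ.baseChange ℂ) μ ⊓ H.piece 0 1), X w = Z w) ∧
        ∀ p ∈ Module.End.eigenspace (φ.baseChange ℂ) μ ⊓ H.piece 1 0, X p = 0) :
    ∀ B : ↥(Module.End.eigenspace (φ.baseChange ℂ) μ ⊓ H.piece 0 1) →ₗ[ℂ] ↥(Module.End.eigenspace (φ.baseChange ℂ) μ ⊓ H.piece 1 0),
      ∃ N ∈ H.hodgeLieC, (∀ p ∈ H.piece 1 0, N p = 0) ∧ (∀ v, N v ∈ H.piece 1 0) ∧
        ∀ w : ↥(Module.End.eigenspace (φ.baseChange ℂ) μ ⊓ H.piece 0 1), N w = B w := by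
  subst hn
  set W := Module.End.eigenspace (φ.baseChange ℂ) μ with hWdef
  set Wp := W ⊓ H.piece 1 0 with hWpdef
  set Wm := W ⊓ H.piece 0 1 with hWmdef
  have hbrC : ∀ Y ∈ H.hodgeLieC, ∀ Z ∈ H.hodgeLieC, Y * Z - Z * Y ∈ H.hodgeLieC := fun Y hY Z hZ => H.commutator_mem_hodgeLieC hY hZ
  have hcφ : ∀ {Y}, Y ∈ H.hodgeLieC → Y * φ.baseChange ℂ = φ.baseChange ℂ * Y := fun {Y} hY =>
    H.commute_baseChange_of_mem_hodgeLieC hY ⟨φ, hφE⟩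
  have hYW : ∀ {Y}, Y ∈ H.hodgeLieC → ∀ w ∈ W, Y w ∈ W := fun {Y} hY w hw =>
    UnitaryTheta.apply_mem_eigenspace_of_commute (hcφ hY) hw
  have hNWm : ∀ {N}, N ∈ H.hodgeLieC → (∀ v, N v ∈ H.piece 1 0) → ∀ w : ↥Wm, N w ∈ Wp := fun {N} hN hNim w =>
    Submodule.mem_inf.2 ⟨hYW hN _ (Submodule.mem_inf.1 w.2).1, hNim _⟩
  -- the subspace of restrictions of raising elements
  let S : Submodule ℂ (↥Wm →ₗ[ℂ] ↥Wp) :=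
    { carrier := {G | ∃ N ∈ H.hodgeLieC, (∀ p ∈ H.piece 1 0, N p = 0) ∧ (∀ v, N v ∈ H.piece 1 0) ∧
        ∀ w : ↥Wm, ((G w : ↥Wp) : ℂ ⊗[ℚ] V) = N w}
      add_mem' := by
        rintro G G' ⟨N, hN, hNP, hNim, hG⟩ ⟨N', hN', hN'P, hN'im, hG'⟩
        refine ⟨N + N', H.hodgeLieC.add_mem hN hN', fun p hp => ?_, fun v => ?_, fun w => ?_⟩
        · rw [LinearMap.add_apply, hNP p hp, hN'P p hp, add_zero]
        · rw [LinearMap.add_apply]; exact Submodule.add_mem _ (hNim v) (hN'im v)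
        · rw [LinearMap.add_apply, Submodule.coe_add, hG, hG', LinearMap.add_apply]
      zero_mem' := ⟨0, H.hodgeLieC.zero_mem, fun p _ => rfl, fun v => Submodule.zero_mem _, fun w => rfl⟩
      smul_mem' := by
        rintro c G ⟨N, hN, hNP, hNim, hG⟩
        refine ⟨c • N, H.hodgeLieC.smul_mem c hN, fun p hp => ?_, fun v => ?_, fun w => ?_⟩
        · rw [LinearMap.smul_apply, hNP p hp, smul_zero]
        · rw [LinearMap.smul_apply]; exact Submodule.smul_mem _ _ (hNim v)
        · rw [LinearMap.smul_apply, Submodule.coe_smul, hG, LinearMap.smul_apply] }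
  have hmemS : ∀ G, G ∈ S ↔ ∃ N ∈ H.hodgeLieC, (∀ p ∈ H.piece 1 0, N p = 0) ∧ (∀ v, N v ∈ H.piece 1 0) ∧
      ∀ w : ↥Wm, ((G w : ↥Wp) : ℂ ⊗[ℚ] V) = N w := fun G => Iff.rfl
  -- `S ≠ 0`
  have hne : S ≠ ⊥ := by
    have hWp0 : Wp ≠ ⊥ := fun h => by
      rw [h, finrank_bot] at hWp
      exact Nat.not_lt_zero 1 hWp
    obtain ⟨N₀, hN₀, hN₀P, hN₀im, w₁, hw₁, hN₀w₁⟩ :=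
      WeilSquare.exists_raising_apply_ne_zero H rfl heff ψ hφE hd hφ2 hμ hz hWp0
    intro hS
    set G₀ : ↥Wm →ₗ[ℂ] ↥Wp := (N₀.domRestrict Wm).codRestrict Wp (fun w => hNWm hN₀ hN₀im w) with hG₀
    have hG₀S : G₀ ∈ S := (hmemS G₀).2 ⟨N₀, hN₀, hN₀P, hN₀im, fun w => rfl⟩
    rw [hS, Submodule.mem_bot] at hG₀S
    have h := congrArg (fun G : ↥Wm →ₗ[ℂ] ↥Wp => ((G ⟨w₁, hw₁⟩ : ↥Wp) : ℂ ⊗[ℚ] V)) hG₀S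
    simp only [hG₀, LinearMap.codRestrict_apply, LinearMap.domRestrict_apply, LinearMap.zero_apply, Submodule.coe_zero] at h
    exact hN₀w₁ h
  -- left stability: `Z ∘ N|_{W⁻} = [X_Z, N]|_{W⁻}`
  have hleft : ∀ Z : Module.End ℂ ↥Wp, LinearMap.trace ℂ _ Z = 0 → ∀ G ∈ S, Z ∘ₗ G ∈ S := by
    intro Z hZ G hG
    obtain ⟨N, hN, hNP, hNim, hGN⟩ := (hmemS G).1 hG
    obtain ⟨X, hX, hXP, -, hXZ, hXm⟩ := hLp Z hZ
    refine (hmemS _).2 ⟨X * N - N * X, hbrC X hX N hN, fun p hp => ?_, fun v => ?_, fun w => ?_⟩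
    · rw [LinearMap.sub_apply, Module.End.mul_apply, Module.End.mul_apply, hNP p hp, map_zero, hNP _ (hXP p hp), sub_zero]
    · rw [LinearMap.sub_apply, Module.End.mul_apply, Module.End.mul_apply]
      exact Submodule.sub_mem _ (hXP _ (hNim v)) (hNim _)
    · have hGw : ((G w : ↥Wp) : ℂ ⊗[ℚ] V) = N w := hGN w
      rw [LinearMap.comp_apply, ← hXZ (G w), hGw, LinearMap.sub_apply, Module.End.mul_apply, Module.End.mul_apply, hXm _ w.2,
        map_zero, sub_zero]
  -- right stability: `N|_{W⁻} ∘ Z = [N, X'_Z]|_{W⁻}`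
  have hright : ∀ Z : Module.End ℂ ↥Wm, LinearMap.trace ℂ _ Z = 0 → ∀ G ∈ S, G ∘ₗ Z ∈ S := by
    intro Z hZ G hG
    obtain ⟨N, hN, hNP, hNim, hGN⟩ := (hmemS G).1 hG
    obtain ⟨X, hX, hXP, -, hXZ, hXp⟩ := hLm Z hZ
    refine (hmemS _).2 ⟨N * X - X * N, hbrC N hN X hX, fun p hp => ?_, fun v => ?_, fun w => ?_⟩
    · rw [LinearMap.sub_apply, Module.End.mul_apply, Module.End.mul_apply, hNP _ (hXP p hp), hNP p hp, map_zero, sub_zero]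
    · rw [LinearMap.sub_apply, Module.End.mul_apply, Module.End.mul_apply]
      exact Submodule.sub_mem _ (hNim _) (hXP _ (hNim v))
    · have hGw : ((G (Z w) : ↥Wp) : ℂ ⊗[ℚ] V) = N (Z w) := hGN (Z w)
      rw [LinearMap.comp_apply, hGw, ← hXZ w, LinearMap.sub_apply, Module.End.mul_apply, Module.End.mul_apply,
        hXp _ (hNWm hN hNim w), sub_zero]
  have htop := Literature.Algebra.Lie.eq_top_of_forall_traceless_comp_mem hWm hWp hne hleft hright
  intro B
  have hB : B ∈ S := htop ▸ Submodule.mem_top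
  obtain ⟨N, hN, hNP, hNim, hBN⟩ := (hmemS B).1 hB
  exact ⟨N, hN, hNP, hNim, fun w => (hBN w).symm⟩

/-- **LIFT ⟹ every linear map `W⁺ → W⁻` is the restriction of a lowering element of `𝔥_ℂ`** (the mirror of
`WeilSquare.exists_raising_restrict_eq_of_lift`: the non-zero lowering element is the complex conjugate of a raising element which is
non-zero on `W̄ ∩ V^{0,1} = conj(W⁺)` by §1 at `−μ`). [cite: Ribet1976RealMultiplications, pp. 790–791]
[cite: Deligne1982HodgeCycles, I §3 (proof of Prop. 3.4)] -/
theorem WeilSquare.exists_lowering_restrict_eq_of_lift (H : HodgeStructure V n) (hn : n = 1) (heff : H.IsEffective)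
    (ψ : H.Polarization) {φ : Module.End ℚ V} (hφE : φ ∈ H.endAlg) {d : ℚ} (hd : 0 < d) (hφ2 : φ * φ = -(d • 1)) {μ : ℂ}
    (hμ : μ ^ 2 = -(d : ℂ)) (hz : H.hodgeLie ⊓ Subalgebra.toSubmodule H.endAlg = ⊥)
    (hWp : 1 < Module.finrank ℂ ↥(Module.End.eigenspace (φ.baseChange ℂ) μ ⊓ H.piece 1 0))
    (hWm : 1 < Module.finrank ℂ ↥(Module.End.eigenspace (φ.baseChange ℂ) μ ⊓ H.piece 0 1))
    (hLp : ∀ Z : Module.End ℂ ↥(Module.End.eigenspace (φ.baseChange ℂ) μ ⊓ H.piece 1 0), LinearMap.trace ℂ _ Z = 0 →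
      ∃ X ∈ H.hodgeLieC, (∀ p ∈ H.piece 1 0, X p ∈ H.piece 1 0) ∧ (∀ q ∈ H.piece 0 1, X q ∈ H.piece 0 1) ∧
        (∀ p : ↥(Module.End.eigenspace (φ.baseChange ℂ) μ ⊓ H.piece 1 0), X p = Z p) ∧
        ∀ w ∈ Module.End.eigenspace (φ.baseChange ℂ) μ ⊓ H.piece 0 1, X w = 0)
    (hLm : ∀ Z : Module.End ℂ ↥(Module.End.eigenspace (φ.baseChange ℂ) μ ⊓ H.piece 0 1), LinearMap.trace ℂ _ Z = 0 →
      ∃ X ∈ H.hodgeLieC, (∀ p ∈ H.piece 1 0, X p ∈ H.piece 1 0) ∧ (∀ q ∈ H.piece 0 1, X q ∈ H.piece 0 1) ∧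
        (∀ w : ↥(Module.End.eigenspace (φ.baseChange ℂ) μ ⊓ H.piece 0 1), X w = Z w) ∧
        ∀ p ∈ Module.End.eigenspace (φ.baseChange ℂ) μ ⊓ H.piece 1 0, X p = 0) :
    ∀ C : ↥(Module.End.eigenspace (φ.baseChange ℂ) μ ⊓ H.piece 1 0) →ₗ[ℂ] ↥(Module.End.eigenspace (φ.baseChange ℂ) μ ⊓ H.piece 0 1),
      ∃ M ∈ H.hodgeLieC, (∀ q ∈ H.piece 0 1, M q = 0) ∧ (∀ v, M v ∈ H.piece 0 1) ∧
        ∀ p : ↥(Module.End.eigenspace (φ.baseChange ℂ) μ ⊓ H.piece 1 0), M p = C p := by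
  subst hn
  set W := Module.End.eigenspace (φ.baseChange ℂ) μ with hWdef
  set Wp := W ⊓ H.piece 1 0 with hWpdef
  set Wm := W ⊓ H.piece 0 1 with hWmdef
  obtain ⟨hμ0, hμc⟩ := UnitaryTheta.conj_eq_neg_of_sq hd hμ
  have hbrC : ∀ Y ∈ H.hodgeLieC, ∀ Z ∈ H.hodgeLieC, Y * Z - Z * Y ∈ H.hodgeLieC := fun Y hY Z hZ => H.commutator_mem_hodgeLieC hY hZ
  have hcφ : ∀ {Y}, Y ∈ H.hodgeLieC → Y * φ.baseChange ℂ = φ.baseChange ℂ * Y := fun {Y} hY =>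
    H.commute_baseChange_of_mem_hodgeLieC hY ⟨φ, hφE⟩
  have hYW : ∀ {Y}, Y ∈ H.hodgeLieC → ∀ w ∈ W, Y w ∈ W := fun {Y} hY w hw =>
    UnitaryTheta.apply_mem_eigenspace_of_commute (hcφ hY) hw
  have hPQ : ∀ x ∈ H.piece 1 0, conj x ∈ H.piece 0 1 := fun x hx => conj_mem_piece H hx
  have hQP : ∀ x ∈ H.piece 0 1, conj x ∈ H.piece 1 0 := fun x hx => conj_mem_piece H hx
  have hcW : ∀ x ∈ W, conj x ∈ Module.End.eigenspace (φ.baseChange ℂ) (-μ) := fun x hx =>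
    (UnitaryTheta.conj_mem_eigenspace_iff φ hμc x).2 hx
  have hMWp : ∀ {M}, M ∈ H.hodgeLieC → (∀ v, M v ∈ H.piece 0 1) → ∀ p : ↥Wp, M p ∈ Wm := fun {M} hM hMim p =>
    Submodule.mem_inf.2 ⟨hYW hM _ (Submodule.mem_inf.1 p.2).1, hMim _⟩
  let S : Submodule ℂ (↥Wp →ₗ[ℂ] ↥Wm) :=
    { carrier := {G | ∃ M ∈ H.hodgeLieC, (∀ q ∈ H.piece 0 1, M q = 0) ∧ (∀ v, M v ∈ H.piece 0 1) ∧
        ∀ p : ↥Wp, ((G p : ↥Wm) : ℂ ⊗[ℚ] V) = M p}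
      add_mem' := by
        rintro G G' ⟨M, hM, hMQ, hMim, hG⟩ ⟨M', hM', hM'Q, hM'im, hG'⟩
        refine ⟨M + M', H.hodgeLieC.add_mem hM hM', fun q hq => ?_, fun v => ?_, fun p => ?_⟩
        · rw [LinearMap.add_apply, hMQ q hq, hM'Q q hq, add_zero]
        · rw [LinearMap.add_apply]; exact Submodule.add_mem _ (hMim v) (hM'im v)
        · rw [LinearMap.add_apply, Submodule.coe_add, hG, hG', LinearMap.add_apply]
      zero_mem' := ⟨0, H.hodgeLieC.zero_mem, fun q _ => rfl, fun v => Submodule.zero_mem _, fun p => rfl⟩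
      smul_mem' := by
        rintro c G ⟨M, hM, hMQ, hMim, hG⟩
        refine ⟨c • M, H.hodgeLieC.smul_mem c hM, fun q hq => ?_, fun v => ?_, fun p => ?_⟩
        · rw [LinearMap.smul_apply, hMQ q hq, smul_zero]
        · rw [LinearMap.smul_apply]; exact Submodule.smul_mem _ _ (hMim v)
        · rw [LinearMap.smul_apply, Submodule.coe_smul, hG, LinearMap.smul_apply] }
  have hmemS : ∀ G, G ∈ S ↔ ∃ M ∈ H.hodgeLieC, (∀ q ∈ H.piece 0 1, M q = 0) ∧ (∀ v, M v ∈ H.piece 0 1) ∧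
      ∀ p : ↥Wp, ((G p : ↥Wm) : ℂ ⊗[ℚ] V) = M p := fun G => Iff.rfl
  -- `S ≠ 0`: the conjugate `M₀ = N̄₀` of a raising `N₀ ≠ 0`; `M₀|_{W⁺} ≠ 0` since `N₀ ≠ 0` on `W̄ ∩ V^{0,1}` (§1 at `−μ`)
  have hne : S ≠ ⊥ := by
    have hWp0 : Wp ≠ ⊥ := fun h => by
      rw [h, finrank_bot] at hWp
      exact Nat.not_lt_zero 1 hWp
    obtain ⟨N₀, hN₀, hN₀P, hN₀im, w₁, hw₁, hN₀w₁⟩ :=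
      WeilSquare.exists_raising_apply_ne_zero H rfl heff ψ hφE hd hφ2 hμ hz hWp0
    obtain ⟨M₀, hM₀⟩ := exists_conjOp N₀
    have hM₀𝔥 : M₀ ∈ H.hodgeLieC := by
      rw [hodgeLieC_eq_spanC] at hN₀ ⊢
      exact conjOp_mem_spanC hN₀ hM₀
    have hM₀Q : ∀ q ∈ H.piece 0 1, M₀ q = 0 := fun q hq => by rw [hM₀, hN₀P _ (hQP q hq), map_zero]
    have hM₀im : ∀ v, M₀ v ∈ H.piece 0 1 := fun v => by rw [hM₀]; exact hPQ _ (hN₀im _)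
    -- `N₀` is non-zero on `W̄ ∩ V^{0,1}`
    have hN₀bar : ∃ x ∈ Module.End.eigenspace (φ.baseChange ℂ) (-μ) ⊓ H.piece 0 1, N₀ x ≠ 0 := by
      by_contra hcon
      push Not at hcon
      have hμ' : (-μ) ^ 2 = -(d : ℂ) := by rw [neg_sq]; exact hμ
      have h0 := WeilSquare.raising_eq_zero_of_forall_minus H rfl heff ψ hφE hd hφ2 hμ' hN₀ hN₀P hN₀im hcon
      rw [h0, LinearMap.zero_apply] at hN₀w₁
      exact hN₀w₁ rfl
    obtain ⟨x, hx, hN₀x⟩ := hN₀bar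
    have hcx : conj x ∈ Wp := Submodule.mem_inf.2
      ⟨(UnitaryTheta.conj_mem_eigenspace_iff' φ hμc x).2 (Submodule.mem_inf.1 hx).1, hQP _ (Submodule.mem_inf.1 hx).2⟩
    intro hS
    set G₀ : ↥Wp →ₗ[ℂ] ↥Wm := (M₀.domRestrict Wp).codRestrict Wm (fun p => hMWp hM₀𝔥 hM₀im p) with hG₀
    have hG₀S : G₀ ∈ S := (hmemS G₀).2 ⟨M₀, hM₀𝔥, hM₀Q, hM₀im, fun p => rfl⟩
    rw [hS, Submodule.mem_bot] at hG₀S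
    have h := congrArg (fun G : ↥Wp →ₗ[ℂ] ↥Wm => ((G ⟨conj x, hcx⟩ : ↥Wm) : ℂ ⊗[ℚ] V)) hG₀S
    simp only [hG₀, LinearMap.codRestrict_apply, LinearMap.domRestrict_apply, LinearMap.zero_apply, Submodule.coe_zero] at h
    rw [hM₀, conj_conj] at h
    exact hN₀x (by rw [← conj_conj (N₀ x), h, map_zero])
  have hleft : ∀ Z : Module.End ℂ ↥Wm, LinearMap.trace ℂ _ Z = 0 → ∀ G ∈ S, Z ∘ₗ G ∈ S := by
    intro Z hZ G hG
    obtain ⟨M, hM, hMQ, hMim, hGM⟩ := (hmemS G).1 hG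
    obtain ⟨X, hX, -, hXQ, hXZ, hXp⟩ := hLm Z hZ
    refine (hmemS _).2 ⟨X * M - M * X, hbrC X hX M hM, fun q hq => ?_, fun v => ?_, fun p => ?_⟩
    · rw [LinearMap.sub_apply, Module.End.mul_apply, Module.End.mul_apply, hMQ q hq, map_zero, hMQ _ (hXQ q hq), sub_zero]
    · rw [LinearMap.sub_apply, Module.End.mul_apply, Module.End.mul_apply]
      exact Submodule.sub_mem _ (hXQ _ (hMim v)) (hMim _)
    · have hGp : ((G p : ↥Wm) : ℂ ⊗[ℚ] V) = M p := hGM p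
      rw [LinearMap.comp_apply, ← hXZ (G p), hGp, LinearMap.sub_apply, Module.End.mul_apply, Module.End.mul_apply, hXp _ p.2,
        map_zero, sub_zero]
  have hright : ∀ Z : Module.End ℂ ↥Wp, LinearMap.trace ℂ _ Z = 0 → ∀ G ∈ S, G ∘ₗ Z ∈ S := by
    intro Z hZ G hG
    obtain ⟨M, hM, hMQ, hMim, hGM⟩ := (hmemS G).1 hG
    obtain ⟨X, hX, -, hXQ, hXZ, hXm⟩ := hLp Z hZ
    refine (hmemS _).2 ⟨M * X - X * M, hbrC M hM X hX, fun q hq => ?_, fun v => ?_, fun p => ?_⟩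
    · rw [LinearMap.sub_apply, Module.End.mul_apply, Module.End.mul_apply, hMQ _ (hXQ q hq), hMQ q hq, map_zero, sub_zero]
    · rw [LinearMap.sub_apply, Module.End.mul_apply, Module.End.mul_apply]
      exact Submodule.sub_mem _ (hMim _) (hXQ _ (hMim v))
    · have hGp : ((G (Z p) : ↥Wm) : ℂ ⊗[ℚ] V) = M (Z p) := hGM (Z p)
      rw [LinearMap.comp_apply, hGp, ← hXZ p, LinearMap.sub_apply, Module.End.mul_apply, Module.End.mul_apply,
        hXm _ (hMWp hM hMim p), sub_zero]
  have htop := Literature.Algebra.Lie.eq_top_of_forall_traceless_comp_mem hWp hWm hne hleft hright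
  intro C
  have hC : C ∈ S := htop ▸ Submodule.mem_top
  obtain ⟨M, hM, hMQ, hMim, hCM⟩ := (hmemS C).1 hC
  exact ⟨M, hM, hMQ, hMim, fun p => (hCM p).symm⟩

/-! ### §3 LIFT ⟹ the membership criterion «`Lie Hg ⊗ ℂ ⊇ 𝔰𝔲_K ⊗ ℂ`» -/

set_option maxHeartbeats 1600000 in
/-- **LIFT ⟹ every `φ_ℂ`-commuting, `ψ_ℂ`-skew operator traceless on `W` lies in `𝔥_ℂ`** (`dim W⁺ = dim W⁻ = 3`, `𝔷(𝔥) = 0`). Write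
`π⁺ = ½(1 + Θ)`, `π⁻ = ½(1 − Θ)`; the blocks `A = π⁺Y|_{W⁺}`, `B = π⁺Y|_{W⁻}`, `C = π⁻Y|_{W⁺}`, `D = π⁻Y|_{W⁻}` of `Y|_W` satisfy
`tr A + tr D = tr(Y|_W) = 0`; with `a = tr A / 3`, the element `X = X_{A − a} + X_{D + a} + aΘ + N_B + M_C ∈ 𝔥_ℂ` (lifts of the traceless
diagonal blocks vanishing on the other summand, §2 for the off-diagonal blocks) agrees with `Y` on `W`, and `Y − X` (commuting with `φ_ℂ`,
`ψ_ℂ`-skew, zero on `W`) vanishes (`UnitaryTheta.eq_zero_of_forall_mem_eigenspace`). [cite: Gordon1997, §6 (proof of Thm. 6.3.3, pp. 18–19)]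
[cite: Deligne1982HodgeCycles, §4 (p. 30)] [cite: MoonenZarhin1999LowDim, §2 (2.3)] -/
theorem WeilSquare.mem_hodgeLieC_of_lift [Nontrivial V] (H : HodgeStructure V n) (hn : n = 1) (heff : H.IsEffective)
    (ψ : H.Polarization) {φ : Module.End ℚ V} (hφE : φ ∈ H.endAlg) {d : ℚ} (hd : 0 < d) (hφ2 : φ * φ = -(d • 1))
    (hE : ∀ a ∈ H.endAlg, ∃ x y : ℚ, a = x • 1 + y • φ) {μ : ℂ} (hμ : μ ^ 2 = -(d : ℂ))
    (hz : H.hodgeLie ⊓ Subalgebra.toSubmodule H.endAlg = ⊥)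
    (hWp : Module.finrank ℂ ↥(Module.End.eigenspace (φ.baseChange ℂ) μ ⊓ H.piece 1 0) = 3)
    (hWm : Module.finrank ℂ ↥(Module.End.eigenspace (φ.baseChange ℂ) μ ⊓ H.piece 0 1) = 3)
    (hLp : ∀ Z : Module.End ℂ ↥(Module.End.eigenspace (φ.baseChange ℂ) μ ⊓ H.piece 1 0), LinearMap.trace ℂ _ Z = 0 →
      ∃ X ∈ H.hodgeLieC, (∀ p ∈ H.piece 1 0, X p ∈ H.piece 1 0) ∧ (∀ q ∈ H.piece 0 1, X q ∈ H.piece 0 1) ∧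
        (∀ p : ↥(Module.End.eigenspace (φ.baseChange ℂ) μ ⊓ H.piece 1 0), X p = Z p) ∧
        ∀ w ∈ Module.End.eigenspace (φ.baseChange ℂ) μ ⊓ H.piece 0 1, X w = 0)
    (hLm : ∀ Z : Module.End ℂ ↥(Module.End.eigenspace (φ.baseChange ℂ) μ ⊓ H.piece 0 1), LinearMap.trace ℂ _ Z = 0 →
      ∃ X ∈ H.hodgeLieC, (∀ p ∈ H.piece 1 0, X p ∈ H.piece 1 0) ∧ (∀ q ∈ H.piece 0 1, X q ∈ H.piece 0 1) ∧
        (∀ w : ↥(Module.End.eigenspace (φ.baseChange ℂ) μ ⊓ H.piece 0 1), X w = Z w) ∧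
        ∀ p ∈ Module.End.eigenspace (φ.baseChange ℂ) μ ⊓ H.piece 1 0, X p = 0)
    {Y : Module.End ℂ (ℂ ⊗[ℚ] V)} (hYφ : Y * φ.baseChange ℂ = φ.baseChange ℂ * Y)
    (hYskew : ∀ x y, ψ.form.baseChange ℂ (Y x) y + ψ.form.baseChange ℂ x (Y y) = 0)
    (hYW : ∀ w ∈ Module.End.eigenspace (φ.baseChange ℂ) μ, Y w ∈ Module.End.eigenspace (φ.baseChange ℂ) μ)
    (htr : LinearMap.trace ℂ _ (Y.restrict hYW) = 0) : Y ∈ H.hodgeLieC := by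
  classical
  subst hn
  set W := Module.End.eigenspace (φ.baseChange ℂ) μ with hWdef
  set Wp := W ⊓ H.piece 1 0 with hWpdef
  set Wm := W ⊓ H.piece 0 1 with hWmdef
  set ψC := ψ.form.baseChange ℂ with hψC
  obtain ⟨hμ0, -⟩ := UnitaryTheta.conj_eq_neg_of_sq hd hμ
  obtain ⟨Θ, hΘ⟩ := exists_hodgeTheta H
  obtain ⟨hPmem, hQmem, hΘ10, hΘ01, -⟩ := UnitaryTheta.theta_facts H rfl heff hΘ
  have hΘ𝔥 : Θ ∈ H.hodgeLieC := H.mem_hodgeLieC_of_forall_piece hΘ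
  have hcφ : ∀ {X}, X ∈ H.hodgeLieC → X * φ.baseChange ℂ = φ.baseChange ℂ * X := fun {X} hX =>
    H.commute_baseChange_of_mem_hodgeLieC hX ⟨φ, hφE⟩
  have hXW : ∀ {X}, X ∈ H.hodgeLieC → ∀ w ∈ W, X w ∈ W := fun {X} hX w hw =>
    UnitaryTheta.apply_mem_eigenspace_of_commute (hcφ hX) hw
  have hskew : ∀ {X}, X ∈ H.hodgeLieC → ∀ x y, ψC (X x) y = -ψC x (X y) := fun {X} hX x y =>
    formBaseChange_skew_of_mem_hodgeLieC ψ hX x y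
  -- the Hodge projectors `π⁺ = ½(1 + Θ)`, `π⁻ = ½(1 − Θ)`
  set πP : Module.End ℂ (ℂ ⊗[ℚ] V) := (2 : ℂ)⁻¹ • (1 + Θ) with hπPdef
  set πQ : Module.End ℂ (ℂ ⊗[ℚ] V) := (2 : ℂ)⁻¹ • (1 - Θ) with hπQdef
  have hπP : ∀ v, πP v = (2 : ℂ)⁻¹ • (v + Θ v) := fun v => by
    rw [hπPdef, LinearMap.smul_apply, LinearMap.add_apply, Module.End.one_apply]
  have hπQ : ∀ v, πQ v = (2 : ℂ)⁻¹ • (v - Θ v) := fun v => by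
    rw [hπQdef, LinearMap.smul_apply, LinearMap.sub_apply, Module.End.one_apply]
  have hπPQ : ∀ v, πP v + πQ v = v := fun v => by
    rw [hπP, hπQ, ← smul_add, add_add_sub_cancel, ← two_smul ℂ v, smul_smul, inv_mul_cancel₀ (two_ne_zero' ℂ), one_smul]
  have hπPW : ∀ w ∈ W, πP w ∈ Wp := fun w hw => by
    rw [hπP]
    exact Submodule.mem_inf.2 ⟨Submodule.smul_mem _ _ (Submodule.add_mem _ hw (hXW hΘ𝔥 w hw)), hπP w ▸ hPmem w⟩
  have hπQW : ∀ w ∈ W, πQ w ∈ Wm := fun w hw => by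
    rw [hπQ]
    exact Submodule.mem_inf.2 ⟨Submodule.smul_mem _ _ (Submodule.sub_mem _ hw (hXW hΘ𝔥 w hw)), hπQ w ▸ hQmem w⟩
  have hπPp : ∀ p ∈ H.piece 1 0, πP p = p := fun p hp => by
    rw [hπP, hΘ10 p hp, ← two_smul ℂ p, smul_smul, inv_mul_cancel₀ (two_ne_zero' ℂ), one_smul]
  have hπQq : ∀ q ∈ H.piece 0 1, πQ q = q := fun q hq => by
    rw [hπQ, hΘ01 q hq, sub_neg_eq_add, ← two_smul ℂ q, smul_smul, inv_mul_cancel₀ (two_ne_zero' ℂ), one_smul]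
  have hπPq : ∀ q ∈ H.piece 0 1, πP q = 0 := fun q hq => by rw [hπP, hΘ01 q hq, add_neg_cancel, smul_zero]
  have hπQp : ∀ p ∈ H.piece 1 0, πQ p = 0 := fun p hp => by rw [hπQ, hΘ10 p hp, sub_self, smul_zero]
  -- the four blocks of `Y|_W`
  have hPY : ∀ x ∈ W, (πP * Y) x ∈ Wp := fun x hx => hπPW _ (hYW x hx)
  have hQY : ∀ x ∈ W, (πQ * Y) x ∈ Wm := fun x hx => hπQW _ (hYW x hx)
  set A : Module.End ℂ ↥Wp := (πP * Y).restrict fun x hx => hPY x (Submodule.mem_inf.1 hx).1 with hAdef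
  set B : ↥Wm →ₗ[ℂ] ↥Wp := (πP * Y).restrict fun x hx => hPY x (Submodule.mem_inf.1 hx).1 with hBdef
  set C : ↥Wp →ₗ[ℂ] ↥Wm := (πQ * Y).restrict fun x hx => hQY x (Submodule.mem_inf.1 hx).1 with hCdef
  set D : Module.End ℂ ↥Wm := (πQ * Y).restrict fun x hx => hQY x (Submodule.mem_inf.1 hx).1 with hDdef
  have hA : ∀ p : ↥Wp, ((A p : ↥Wp) : ℂ ⊗[ℚ] V) = πP (Y p) := fun p => by rw [hAdef, LinearMap.coe_restrict_apply, Module.End.mul_apply]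
  have hB : ∀ w : ↥Wm, ((B w : ↥Wp) : ℂ ⊗[ℚ] V) = πP (Y w) := fun w => by rw [hBdef, LinearMap.coe_restrict_apply, Module.End.mul_apply]
  have hC : ∀ p : ↥Wp, ((C p : ↥Wm) : ℂ ⊗[ℚ] V) = πQ (Y p) := fun p => by rw [hCdef, LinearMap.coe_restrict_apply, Module.End.mul_apply]
  have hD : ∀ w : ↥Wm, ((D w : ↥Wm) : ℂ ⊗[ℚ] V) = πQ (Y w) := fun w => by rw [hDdef, LinearMap.coe_restrict_apply, Module.End.mul_apply]
  -- trace bookkeeping: `tr(Y|_W) = tr A + tr D`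
  set PW : Module.End ℂ (ℂ ⊗[ℚ] V) := (2 * μ)⁻¹ • (μ • (1 : Module.End ℂ (ℂ ⊗[ℚ] V)) + φ.baseChange ℂ) with hPWdef
  obtain ⟨hPWmem, hPWid, -⟩ := CentralEigen.projector_facts (V := V) hφ2 hμ hμ0
  set Pp : Module.End ℂ (ℂ ⊗[ℚ] V) := πP * PW with hPpdef
  set Pm : Module.End ℂ (ℂ ⊗[ℚ] V) := πQ * PW with hPmdef
  have hPp_mem : ∀ v, Pp v ∈ Wp := fun v => by rw [hPpdef, Module.End.mul_apply]; exact hπPW _ (hPWmem v)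
  have hPm_mem : ∀ v, Pm v ∈ Wm := fun v => by rw [hPmdef, Module.End.mul_apply]; exact hπQW _ (hPWmem v)
  have hPp_id : ∀ p ∈ Wp, Pp p = p := fun p hp => by
    rw [hPpdef, Module.End.mul_apply, hPWid p (Submodule.mem_inf.1 hp).1, hπPp p (Submodule.mem_inf.1 hp).2]
  have hPm_id : ∀ w ∈ Wm, Pm w = w := fun w hw => by
    rw [hPmdef, Module.End.mul_apply, hPWid w (Submodule.mem_inf.1 hw).1, hπQq w (Submodule.mem_inf.1 hw).2]
  have hPsum : Pp + Pm = PW := by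
    refine LinearMap.ext fun v => ?_
    rw [LinearMap.add_apply, hPpdef, hPmdef, Module.End.mul_apply, Module.End.mul_apply, hπPQ]
  have htrW : LinearMap.trace ℂ _ (Y.restrict hYW) = LinearMap.trace ℂ _ (Y * PW) :=
    (WeilSquare.trace_mul_proj_eq_trace_restrict hPWmem hPWid hYW).symm
  -- `tr(Y Pp) = tr A`
  have hblock : ∀ {Pr : Module.End ℂ (ℂ ⊗[ℚ] V)} {U : Submodule ℂ (ℂ ⊗[ℚ] V)} (hPmem : ∀ v, Pr v ∈ U) (hPrid : ∀ u ∈ U, Pr u = u)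
      {E : Module.End ℂ ↥U} (hE : ∀ u : ↥U, ((E u : ↥U) : ℂ ⊗[ℚ] V) = Pr (Y u)),
      LinearMap.trace ℂ _ (Y * Pr) = LinearMap.trace ℂ _ E := by
    intro Pr U hPmem hPrid E hE
    have hG : ∀ u ∈ U, (Pr * Y) u ∈ U := fun u _ => by rw [Module.End.mul_apply]; exact hPmem _
    have hPrPr : Pr * Pr = Pr := LinearMap.ext fun v => by rw [Module.End.mul_apply, hPrid _ (hPmem v)]
    have h1 : LinearMap.trace ℂ _ (Y * Pr) = LinearMap.trace ℂ _ ((Pr * Y) * Pr) := by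
      rw [LinearMap.trace_mul_comm ℂ Y Pr, LinearMap.trace_mul_comm ℂ (Pr * Y) Pr, ← mul_assoc, hPrPr]
    have h2 : (Pr * Y).restrict hG = E := LinearMap.ext fun u => Subtype.ext (by
      rw [LinearMap.coe_restrict_apply, hE u, Module.End.mul_apply])
    rw [h1, WeilSquare.trace_mul_proj_eq_trace_restrict hPmem hPrid hG, h2]
  have htrA : LinearMap.trace ℂ _ (Y * Pp) = LinearMap.trace ℂ _ A :=
    hblock hPp_mem hPp_id fun p => by rw [hA, hPpdef, Module.End.mul_apply, hPWid _ (hYW _ (Submodule.mem_inf.1 p.2).1)]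
  have htrD : LinearMap.trace ℂ _ (Y * Pm) = LinearMap.trace ℂ _ D :=
    hblock hPm_mem hPm_id fun w => by rw [hD, hPmdef, Module.End.mul_apply, hPWid _ (hYW _ (Submodule.mem_inf.1 w.2).1)]
  have htrAD : LinearMap.trace ℂ _ A + LinearMap.trace ℂ _ D = 0 := by
    rw [← htrA, ← htrD, ← map_add, ← mul_add, hPsum, ← htrW, htr]
  -- traceless diagonal blocks and their lifts
  set a : ℂ := (3 : ℂ)⁻¹ * LinearMap.trace ℂ _ A with hadef
  have h1p' : LinearMap.trace ℂ ↥Wp (1 : Module.End ℂ ↥Wp) = 3 := by rw [LinearMap.trace_one, hWp]; norm_num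
  have h1m' : LinearMap.trace ℂ ↥Wm (1 : Module.End ℂ ↥Wm) = 3 := by rw [LinearMap.trace_one, hWm]; norm_num
  have hA₀ : LinearMap.trace ℂ _ (A + (-a) • (1 : Module.End ℂ ↥Wp)) = 0 := by
    simp only [map_add, map_smul, h1p', hadef, smul_eq_mul]
    ring
  have hD₀ : LinearMap.trace ℂ _ (D + a • (1 : Module.End ℂ ↥Wm)) = 0 := by
    simp only [map_add, map_smul, h1m', hadef, smul_eq_mul]
    linear_combination htrAD
  obtain ⟨XA, hXA, hXAP, hXAQ, hXAval, hXAm⟩ := hLp (A + (-a) • (1 : Module.End ℂ ↥Wp)) hA₀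
  obtain ⟨XD, hXD, hXDP, hXDQ, hXDval, hXDp⟩ := hLm (D + a • (1 : Module.End ℂ ↥Wm)) hD₀
  have h1p : 1 < Module.finrank ℂ ↥Wp := by rw [hWp]; norm_num
  have h1m : 1 < Module.finrank ℂ ↥Wm := by rw [hWm]; norm_num
  obtain ⟨NB, hNB, hNBP, hNBim, hNBval⟩ :=
    WeilSquare.exists_raising_restrict_eq_of_lift H rfl heff ψ hφE hd hφ2 hμ hz h1p h1m hLp hLm B
  obtain ⟨MC, hMC, hMCQ, hMCim, hMCval⟩ :=
    WeilSquare.exists_lowering_restrict_eq_of_lift H rfl heff ψ hφE hd hφ2 hμ hz h1p h1m hLp hLm C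
  set X : Module.End ℂ (ℂ ⊗[ℚ] V) := XA + XD + a • Θ + NB + MC with hXdef
  have hX𝔥 : X ∈ H.hodgeLieC :=
    H.hodgeLieC.add_mem (H.hodgeLieC.add_mem (H.hodgeLieC.add_mem (H.hodgeLieC.add_mem hXA hXD) (H.hodgeLieC.smul_mem a hΘ𝔥)) hNB) hMC
  have hXapply : ∀ v, X v = XA v + XD v + a • Θ v + NB v + MC v := fun v => by
    simp only [hXdef, LinearMap.add_apply, LinearMap.smul_apply]
  -- `X = Y` on `W⁺` and on `W⁻`
  have hXp : ∀ p ∈ Wp, X p = Y p := by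
    intro p hp
    have hpP : p ∈ H.piece 1 0 := (Submodule.mem_inf.1 hp).2
    have h1 : XA p = πP (Y p) + (-a) • p := by
      have h := hXAval ⟨p, hp⟩
      rw [LinearMap.add_apply, LinearMap.smul_apply, Module.End.one_apply, Submodule.coe_add, Submodule.coe_smul, hA] at h
      exact h
    have h2 : MC p = πQ (Y p) := by rw [hMCval ⟨p, hp⟩, hC]
    rw [hXapply, h1, hXDp p hp, hΘ10 p hpP, hNBP p hpP, h2, neg_smul]
    conv_rhs => rw [← hπPQ (Y p)]
    abel
  have hXm : ∀ w ∈ Wm, X w = Y w := by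
    intro w hw
    have hwQ : w ∈ H.piece 0 1 := (Submodule.mem_inf.1 hw).2
    have h1 : XD w = πQ (Y w) + a • w := by
      have h := hXDval ⟨w, hw⟩
      rw [LinearMap.add_apply, LinearMap.smul_apply, Module.End.one_apply, Submodule.coe_add, Submodule.coe_smul, hD] at h
      exact h
    have h2 : NB w = πP (Y w) := by rw [hNBval ⟨w, hw⟩, hB]
    rw [hXapply, hXAm w hw, h1, hΘ01 w hwQ, h2, hMCQ w hwQ, smul_neg]
    conv_rhs => rw [← hπPQ (Y w)]
    abel
  -- `Y − X` commutes with `φ_ℂ`, is skew, and vanishes on `W`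
  have hDφ : (Y - X) * φ.baseChange ℂ = φ.baseChange ℂ * (Y - X) := by rw [sub_mul, mul_sub, hYφ, hcφ hX𝔥]
  have hDskew : ∀ x y, ψC ((Y - X) x) y + ψC x ((Y - X) y) = 0 := fun x y => by
    rw [LinearMap.sub_apply, LinearMap.sub_apply, map_sub, LinearMap.sub_apply, map_sub, hskew hX𝔥]
    linear_combination hYskew x y
  have hDW : ∀ w ∈ W, (Y - X) w = 0 := fun w hw => by
    rw [LinearMap.sub_apply, sub_eq_zero, ← hπPQ w, map_add, map_add, hXp _ (hπPW w hw), hXm _ (hπQW w hw)]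
  have h0 := UnitaryTheta.eq_zero_of_forall_mem_eigenspace H ψ hφE hd hφ2 hE hμ hDφ hDskew hDW
  rw [sub_eq_zero] at h0
  rw [h0]
  exact hX𝔥

end HodgeStructure

end Literature.AlgebraicGeometry.Motives

end
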